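import Summits.BirchSwinnertonDyer.BirchSwinnertonDyer.Theorems.TameQuarticManinParityOrientationOfManinTwistEquality
import Summits.BirchSwinnertonDyer.BirchSwinnertonDyer.Theorems.TameQuarticManinParityOptimalTwistNeronLattice
import HarnessLib

/-!
# Route `TameQuarticManinParity`, LINE 22/25 (bsd-idea-3 g8): the orientation O22 ⟸ «the optimal Manin constants of the
# (III, III*) twist pair agree up to sign», BY NAME and with NO other open input (`--supports` O22 stmt-28139)

Cell `pub/bsd-wall`, D-0145 line `route-BirchSwinnertonDyer-TeichmullerTwistDescent`, seat `bsd-line-ttd-p1` g10.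
BSD is NOT proved by this; Manin's conjecture is not proved by this; O22 (`TprimeIrrTwistLatticeOrientation`, 28139)
stays OPEN. K25 (`tprimeIrrOrientationOfManinTwistEquality_proof`) took T24L as a hypothesis; T24L is now a theorem
(`tprimeIrrOptimalTwistNeronLattice_proof`, LINE 25 chain α → T24L proved outright), so the Manin dictionary holds
unconditionally: for the optimal type-III datum `D` and the optimal twisted datum `D'`, `D.c = ±D'.c` implies
`Λ(D.f) ⊆ g(χ₋₃)·Λ(D.f ⊗ χ₋₃)`. With M25 (`tprimeIrrTwistPairManinDivisibility_proof`: `D'.c ∣ D.c ∣ 3·D'.c`) the only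
other possibility is `D.c = ±3·D'.c`. Design: one composition; no definition, no named fact, no `sorry`.
-/

set_option autoImplicit false
-- D-0017: single-problem summit, so `Summit.BirchSwinnertonDyer.BirchSwinnertonDyer.…` repeats a namespace BY DESIGN.
set_option linter.dupNamespace false

noncomputable section

namespace Summit.BirchSwinnertonDyer.BirchSwinnertonDyer.Theorems.TameQuarticManinParity

open Literature.NumberTheory.EllipticCurves Literature.NumberTheory.EllipticCurves.ModularForms
  Summit.BirchSwinnertonDyer.BirchSwinnertonDyer.Theses.TameQuarticManinParity

/-- **O22's inclusion from Manin-constant equality on the optimal twist pair, unconditionally** (K25 ∘ T24L): for `W`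
type III irreducible (t′) non-CM with optimal datum `D`, `A` with optimal datum `D'` for `D.f ⊗ χ₋₃`, `D.c ≠ 0` and
`D.c = ±D'.c`: `Λ(D.f) ⊆ g(χ)·Λ(D.f ⊗ χ)`. [cite: Stevens1989, Lemmas (5.2), (5.4)] -/
theorem periodLattice_le_gaussSum_mul_of_maninConstant_eq
    (W : WeierstrassCurve ℚ) [W.IsElliptic] [W.IsGloballyMinimal] [NeZero (W.conductorNorm ℤ)] (hcm : ¬ W.HasCM)
    (hadd : Rank1Residual.Addv W 3) (ht : Summit.BirchSwinnertonDyer.Rank1Residual.Additive.SubTprime W 3)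
    (hirr : W.HasIrreducibleModPGaloisRep 3) (h3 : padicValInt 3 W.minimalDiscriminantInt = 3)
    (D : ModularParametrizationData W (W.conductorNorm ℤ))
    (hex : ∀ z ∈ D.L.lattice, ∃ w ∈ periodLattice D.f, z = D.c * w)
    (hmin : ∀ (W' : WeierstrassCurve ℚ) [W'.IsElliptic] (D₁ : ModularParametrizationData W' (W.conductorNorm ℤ)),
      D₁.f = D.f → D.modularDegree ≤ D₁.modularDegree)
    (h9 : 3 ^ 2 ∣ W.conductorNorm ℤ) (χ : DirichletCharacter ℂ 3) (hχ : χ.IsQuadratic) (hprim : χ.IsPrimitive)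
    (A : WeierstrassCurve ℚ) [A.IsElliptic] [A.IsGloballyMinimal]
    (D' : ModularParametrizationData A (W.conductorNorm ℤ))
    (hf : D'.f = charTwist (W.conductorNorm ℤ) (dvd_refl _) h9 hχ D.f)
    (hex' : ∀ z ∈ D'.L.lattice, ∃ w ∈ periodLattice D'.f, z = D'.c * w)
    (hmin' : ∀ (W'' : WeierstrassCurve ℚ) [W''.IsElliptic] (D₁ : ModularParametrizationData W'' (W.conductorNorm ℤ)),
      D₁.f = D'.f → D'.modularDegree ≤ D₁.modularDegree)
    (hc : D.c ≠ 0) (hcc : D.c = D'.c ∨ D.c = -D'.c) :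
    ∀ z ∈ periodLattice D.f, ∃ w ∈ periodLattice (charTwist (W.conductorNorm ℤ) (dvd_refl _) h9 hχ D.f),
      z = gaussSum χ (ZMod.stdAddChar (N := 3)) * w :=
  tprimeIrrOrientationOfManinTwistEquality_proof tprimeIrrOptimalTwistNeronLattice_proof W hcm hadd ht hirr h3 D hex
    hmin h9 χ hχ hprim A D' hf hex' hmin' hc hcc

end Summit.BirchSwinnertonDyer.BirchSwinnertonDyer.Theorems.TameQuarticManinParity

end
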